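import Summits.HubbardSuperconductivity.HubbardSuperconductivity.Theorems.AnisotropyChordTransferFibre3TorusDirichletDual

/-!
# Route `AnisotropyChord` / H0 rotor rung: PROP BS — `TwoHoleGap L g` (HOLE₂) from a FINITE Birman–Schwinger / Green-matrix certificate on the ten points `ζ ∪ ∂ζ`

Second file of PROP BS (memo ROTOR-THEORY-19 §253; memo 21 §314(a) «EXACT REWRITE», §317–§329; theory seat
`hubbard-h0-rotor-theory-1`).  `TwoHoleGap L g` (PORT PartN36, `…Fibre3LemmaVTargets`) is the Poincaré inequality of the
rate-½ walk on every twice-punctured torus `(ℤ/L)² ∖ {z₁,z₂}`; HOLE₂(.75) = `TwoHoleGap L (3/4·ε₁)` is the one one-body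
spectral input of `gm3_of_hole2` (p1 g23).  The theory's ∀L route (per-L exact tables §314/§319/§330, near-pair tail
§317/§321, far pairs via the two-channel theorem PartN40) works with FINITE matrices built from the torus kernel
`a_L = 2·aKer`; this file proves that such finite certificates indeed imply `TwoHoleGap` — the sufficiency half of PROP BS —
in two forms:
* `guarded_sum_eq`: the guarded bond sum of `TwoHoleGap` is `E[f̃] − ½(Σ_e‖f̃(z₁+e)‖² + Σ_e‖f̃(z₂+e)‖²)` for the cut
  function `f̃ = f·1_{∉ζ}` (each boundary point weighted by its deleted-neighbour count `N`);
* `DualCert` / ★ `twoHoleGap_of_dualCert` (`2 ≤ L`, `g < ε₁`): if for every pair every `φ` vanishing on the pair admits a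
  charge `c` with `½·(boundary mass) ≤ 2Re⟨c,φ⟩ − Re Γ_g(c)`, then `TwoHoleGap L g` (by `dual_bound`);
* `MatrixCert E` / ★ `twoHoleGap_of_matrixCert`: the finite form — `E` is ANY `10 × 10` matrix on the points
  `pt : Fin 5 ⊕ Fin 5 → (ℤ/L)²` (PartN40's indexing: centre, `+eₓ, −eₓ, +e_y, −e_y` per hole) with
  `½‖ψ‖² ≤ 2Re⟨Eψ,ψ⟩ − Re (Eψ)ᴴ G̃_DD (Eψ)` for all boundary data `ψ = φ|_D`, `φ|_ζ = 0`; an interval-arithmetic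
  approximate inverse `E ≈ G̃_DD⁻¹` is a legitimate certificate (no exact inverse needed), and coincident points of near
  pairs are handled by multiplicity;
* `matrixCert_of_inverse`: with `G̃_DD·E = 1` the inequality is `Re ψᴴEψ ≥ ½‖ψ‖²` on `{ψ_ζ = 0}`, i.e.
  `[(G̃_DD)⁻¹]_{BB} − ½N ⪰ 0` — the positivity form `P ≻ 0` of §314(a) with capacity `Λ̃ = G̃(0)` (zero mode removed;
  by Sherman–Morrison with `G̃_DD = Λ̃·11ᵀ − A`, `A = (a_L(p − q))`, this is PartN40's `twoHoleP A Λ̃` for disjoint crosses).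
Sanity numerics (prover's scratch, pure python): for `L = 6, 8` and the diagonal pair the least eigenvalue of
`[(G̃_DD)⁻¹]_{BB} − ½N` changes sign exactly at `g/ε₁ = .6524 / .7369`, the true `gap₂/ε₁` (PartN36 table: .652 / .737).
Prover seat `hubbard-h0-rotor-p2` g2; helper for stmt-HubbardSuperconductivity-19089 (`--supports`, helper class).
WHAT THIS IS NOT: nothing here proves superconductivity in the Hubbard model; the rotor TARGET as originally worded stays
FALSE (g15 verdict).  This is the finite reduction behind ONE input (HOLE₂) of ONE conditional reduction (rung 19089); it
certifies nothing by itself — the certificates (per-L tables, analytic tail) are separate work.  Mathlib + tree imports only;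
no sorry, no axioms.
-/

set_option linter.dupNamespace false

noncomputable section

open scoped BigOperators
open Complex Finset

namespace Summit.HubbardSuperconductivity.HubbardSuperconductivity.Theorems.AnisotropyChord.Transfer.Fibre3

namespace TwoHoleBS

variable (L : ℕ) [NeZero L]

/-! ## Guarded-bond bookkeeping: the two-hole Dirichlet form is the torus form minus the boundary mass -/

/-- the function cut to zero on the pair `ζ = {z₁, z₂}`. [folklore] -/
def cut (z₁ z₂ : Tor L) (f : Tor L → ℂ) : Tor L → ℂ := fun x => if x = z₁ ∨ x = z₂ then 0 else f x

/-- boundary mass around a hole: `Σ_e ‖φ(z + e)‖²` (each boundary point counted once per deleted neighbour). [folklore] -/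
def nbr (φ : Tor L → ℂ) (z : Tor L) : ℝ := ((nnList L).map fun e => ‖φ (z + e)‖ ^ 2).sum

omit [NeZero L] in
/-- pointwise form of the guarded bond term. [folklore] -/
theorem guard_pt (z₁ z₂ : Tor L) (f : Tor L → ℂ) (x e : Tor L) :
    (if (x = z₁ ∨ x = z₂ ∨ x + e = z₁ ∨ x + e = z₂) then (0 : ℝ) else ‖f x - f (x + e)‖ ^ 2)
      = ‖cut L z₁ z₂ f x - cut L z₁ z₂ f (x + e)‖ ^ 2
        - (if (x = z₁ ∨ x = z₂) then ‖cut L z₁ z₂ f (x + e)‖ ^ 2 else 0)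
        - (if (x + e = z₁ ∨ x + e = z₂) then ‖cut L z₁ z₂ f x‖ ^ 2 else 0) := by
  unfold cut
  by_cases hx : x = z₁ ∨ x = z₂ <;> by_cases hxe : x + e = z₁ ∨ x + e = z₂ <;> simp [hx, hxe]

/-- `Σ_x [x ∈ ζ] h(x) = h(z₁) + h(z₂)`. [folklore] -/
theorem sum_ite_pair {z₁ z₂ : Tor L} (hne : z₁ ≠ z₂) (h : Tor L → ℝ) :
    ∑ x : Tor L, (if (x = z₁ ∨ x = z₂) then h x else 0) = h z₁ + h z₂ := by
  rw [← Finset.sum_filter]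
  have : (Finset.univ.filter fun x : Tor L => x = z₁ ∨ x = z₂) = {z₁, z₂} := by
    ext x; simp
  rw [this, Finset.sum_pair hne]

/-- `Σ_x [x + e ∈ ζ] h(x) = h(z₁ − e) + h(z₂ − e)`. [folklore] -/
theorem sum_ite_pair_shift {z₁ z₂ : Tor L} (hne : z₁ ≠ z₂) (h : Tor L → ℝ) (e : Tor L) :
    ∑ x : Tor L, (if (x + e = z₁ ∨ x + e = z₂) then h x else 0) = h (z₁ - e) + h (z₂ - e) := by
  have hne' : z₁ - e ≠ z₂ - e := fun h' => hne (sub_left_injective h')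
  rw [← sum_ite_pair L hne' h]
  refine Finset.sum_congr rfl fun x _ => ?_
  simp only [eq_sub_iff_add_eq]

/-- one bond direction of the guarded sum. [folklore] -/
theorem guarded_sum_dir {z₁ z₂ : Tor L} (hne : z₁ ≠ z₂) (f : Tor L → ℂ) (e : Tor L) :
    ∑ x : Tor L, (if (x = z₁ ∨ x = z₂ ∨ x + e = z₁ ∨ x + e = z₂) then (0 : ℝ) else ‖f x - f (x + e)‖ ^ 2)
      = ∑ x : Tor L, ‖cut L z₁ z₂ f x - cut L z₁ z₂ f (x + e)‖ ^ 2
        - (‖cut L z₁ z₂ f (z₁ + e)‖ ^ 2 + ‖cut L z₁ z₂ f (z₂ + e)‖ ^ 2)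
        - (‖cut L z₁ z₂ f (z₁ - e)‖ ^ 2 + ‖cut L z₁ z₂ f (z₂ - e)‖ ^ 2) := by
  simp_rw [guard_pt]
  rw [Finset.sum_sub_distrib, Finset.sum_sub_distrib, sum_ite_pair L hne, sum_ite_pair_shift L hne]

/-- **the two-hole Dirichlet form:** the guarded bond sum of `TwoHoleGap` equals `E[f̃] − ½(Σ_e‖f̃(z₁+e)‖² + Σ_e‖f̃(z₂+e)‖²)`
for the cut function `f̃`. [folklore] -/
theorem guarded_sum_eq {z₁ z₂ : Tor L} (hne : z₁ ≠ z₂) (f : Tor L → ℂ) :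
    (1 / 4 : ℝ) * ∑ x : Tor L, ((nnList L).map (fun e =>
        if (x = z₁ ∨ x = z₂ ∨ x + e = z₁ ∨ x + e = z₂) then (0 : ℝ) else ‖f x - f (x + e)‖ ^ 2)).sum
      = dirichletW L (cut L z₁ z₂ f) - (1 / 2 : ℝ) * (nbr L (cut L z₁ z₂ f) z₁ + nbr L (cut L z₁ z₂ f) z₂) := by
  unfold dirichletW nbr
  simp_rw [nnList_map_sum]
  simp only [Finset.sum_add_distrib]
  rw [guarded_sum_dir L hne f (ex L), guarded_sum_dir L hne f (-ex L), guarded_sum_dir L hne f (ey L),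
    guarded_sum_dir L hne f (-ey L)]
  rw [sub_neg_eq_add, sub_neg_eq_add, sub_neg_eq_add, sub_neg_eq_add,
    sub_eq_add_neg z₁ (ex L), sub_eq_add_neg z₂ (ex L), sub_eq_add_neg z₁ (ey L), sub_eq_add_neg z₂ (ey L)]
  ring

omit [NeZero L] in
/-- `‖f̃ x‖² = [x ∉ ζ] ‖f x‖²`. [folklore] -/
theorem norm_cut_sq (z₁ z₂ : Tor L) (f : Tor L → ℂ) (x : Tor L) :
    ‖cut L z₁ z₂ f x‖ ^ 2 = if (x = z₁ ∨ x = z₂) then (0 : ℝ) else ‖f x‖ ^ 2 := by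
  unfold cut; split_ifs <;> simp

/-! ## PROP BS, dual (Legendre) form -/

/-- per-pair DUAL CERTIFICATE at Poincaré constant `g`: every `φ` vanishing on the pair (with zero mean) admits a charge `c`
whose Legendre value `2Re⟨c,φ⟩ − Re Γ_g(c)` dominates half the boundary mass `½(Σ_e‖φ(z₁+e)‖² + Σ_e‖φ(z₂+e)‖²)`.
(A finite certificate takes `c` supported on `ζ ∪ ∂ζ` and linear in `φ|_{∂ζ}` — see `MatrixCert`.) [folklore] -/
def DualCert (g : ℝ) (z₁ z₂ : Tor L) : Prop :=
  ∀ φ : Tor L → ℂ, φ z₁ = 0 → φ z₂ = 0 → ∑ x : Tor L, φ x = 0 →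
    ∃ c : Tor L → ℂ,
      (1 / 2 : ℝ) * (nbr L φ z₁ + nbr L φ z₂)
        ≤ 2 * (∑ x : Tor L, (starRingEnd ℂ) (c x) * φ x).re - (greenQF L g c).re

/-- **PROP BS (sufficiency, dual form):** for `L ≥ 2` and `g < ε₁`, dual certificates for every pair give the two-hole
Poincaré inequality `TwoHoleGap L g` (HOLE₂ at `g = θε₁`). [folklore] -/
theorem twoHoleGap_of_dualCert (hL : 2 ≤ L) {g : ℝ} (hg : g < eps1 L)
    (h : ∀ z₁ z₂ : Tor L, z₁ ≠ z₂ → DualCert L g z₁ z₂) : TwoHoleGap L g := by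
  intro z₁ z₂ hne f hmean
  have hφ1 : cut L z₁ z₂ f z₁ = 0 := by simp [cut]
  have hφ2 : cut L z₁ z₂ f z₂ = 0 := by simp [cut]
  have hsum : ∑ x : Tor L, cut L z₁ z₂ f x = 0 := hmean
  obtain ⟨c, hc⟩ := h z₁ z₂ hne (cut L z₁ z₂ f) hφ1 hφ2 hsum
  have hd := dual_bound L hL hg (cut L z₁ z₂ f) c hsum
  rw [guarded_sum_eq L hne f]
  have hn : ∑ x : Tor L, (if (x = z₁ ∨ x = z₂) then (0 : ℝ) else ‖f x‖ ^ 2)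
      = ∑ x : Tor L, ‖cut L z₁ z₂ f x‖ ^ 2 := by
    refine Finset.sum_congr rfl fun x _ => ?_
    rw [norm_cut_sq]
  rw [hn]
  linarith


/-! ## PROP BS, finite matrix form on the ten points `ζ ∪ ∂ζ` (PartN40's `Fin 5 ⊕ Fin 5` indexing) -/

/-- the five cluster points of a hole: centre, then `+eₓ, −eₓ, +e_y, −e_y` (PartN40's one-hole `Fin 5` convention:
index `0` = centre, `Fin.succ j` = boundary). [folklore] -/
def clusterPt (z : Tor L) : Fin 5 → Tor L := ![z, z + ex L, z + -ex L, z + ey L, z + -ey L]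

/-- the ten points `ζ ∪ ∂ζ` of a pair, indexed by `Fin 5 ⊕ Fin 5` as in PartN40's `twoHoleP` (for near pairs some of the
ten points coincide — harmless below: a boundary point adjacent to both holes is listed twice, which is exactly its
deleted-neighbour count `N = 2`). [folklore] -/
def bsPt (z₁ z₂ : Tor L) : Fin 5 ⊕ Fin 5 → Tor L := Sum.elim (clusterPt L z₁) (clusterPt L z₂)

/-- boundary data of `φ` on the ten points, `ψ_p = φ(pt p)`. [folklore] -/
def restr (z₁ z₂ : Tor L) (φ : Tor L → ℂ) : Fin 5 ⊕ Fin 5 → ℂ := fun p => φ (bsPt L z₁ z₂ p)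

/-- the `10 × 10` Green matrix of the pair, `G̃_g(pt p − pt q)`. [folklore] -/
def greenMat (g : ℝ) (z₁ z₂ : Tor L) : Matrix (Fin 5 ⊕ Fin 5) (Fin 5 ⊕ Fin 5) ℂ :=
  Matrix.of fun p q => greenW L g (bsPt L z₁ z₂ p - bsPt L z₁ z₂ q)

/-- the lattice charge carried by a vector `w` on the ten points (coincident points add up). [folklore] -/
def chargeOf (z₁ z₂ : Tor L) (w : Fin 5 ⊕ Fin 5 → ℂ) : Tor L → ℂ :=
  fun x => ∑ p : Fin 5 ⊕ Fin 5, if bsPt L z₁ z₂ p = x then w p else 0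

/-- MATRIX CERTIFICATE for the pair at Poincaré constant `g`: a charge map `E` on the ten points (think `E ≈ (G̃_DD)⁻¹`; ANY
matrix is allowed, so an interval-arithmetic approximate inverse is a legitimate certificate) such that for the boundary data
`ψ = φ|_D` of every `φ` vanishing on the pair,
`½ Σ_p ‖ψ_p‖² ≤ 2 Re⟨Eψ, ψ⟩ − Re (Eψ)ᴴ · G̃_DD · (Eψ)`.
With `G̃_DD · E = 1` this is `Re ψᴴ E ψ ≥ ½‖ψ‖²` on `{ψ : ψ_ζ = 0}`, i.e. `[(G̃_DD)⁻¹]_{BB} − ½N ⪰ 0` (`matrixCert_of_inverse`),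
the positivity form `P ≻ 0` of memo 21 §314(a) with the zero mode removed from the capacity. [folklore] -/
def MatrixCert (g : ℝ) (z₁ z₂ : Tor L) (E : Matrix (Fin 5 ⊕ Fin 5) (Fin 5 ⊕ Fin 5) ℂ) : Prop :=
  ∀ φ : Tor L → ℂ, φ z₁ = 0 → φ z₂ = 0 →
    (1 / 2 : ℝ) * ∑ p : Fin 5 ⊕ Fin 5, ‖restr L z₁ z₂ φ p‖ ^ 2
      ≤ 2 * (∑ p : Fin 5 ⊕ Fin 5, (starRingEnd ℂ) (E.mulVec (restr L z₁ z₂ φ) p) * restr L z₁ z₂ φ p).re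
        - (∑ p : Fin 5 ⊕ Fin 5, ∑ q : Fin 5 ⊕ Fin 5,
            (starRingEnd ℂ) (E.mulVec (restr L z₁ z₂ φ) p) * greenMat L g z₁ z₂ p q
              * E.mulVec (restr L z₁ z₂ φ) q).re

omit [NeZero L] in
/-- the boundary mass is the `ℓ²` mass of the boundary data (the two centre slots vanish). [folklore] -/
theorem nbr_add_nbr {z₁ z₂ : Tor L} {φ : Tor L → ℂ} (h1 : φ z₁ = 0) (h2 : φ z₂ = 0) :
    nbr L φ z₁ + nbr L φ z₂ = ∑ p : Fin 5 ⊕ Fin 5, ‖restr L z₁ z₂ φ p‖ ^ 2 := by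
  rw [Fintype.sum_sum_type, Fin.sum_univ_five, Fin.sum_univ_five]
  unfold nbr
  rw [nnList_map_sum, nnList_map_sum]
  simp [restr, bsPt, clusterPt, h1, h2]

/-- pairing a charge carried by the ten points with a lattice function. [folklore] -/
theorem sum_conj_chargeOf_mul (z₁ z₂ : Tor L) (w : Fin 5 ⊕ Fin 5 → ℂ) (F : Tor L → ℂ) :
    ∑ x : Tor L, (starRingEnd ℂ) (chargeOf L z₁ z₂ w x) * F x
      = ∑ p : Fin 5 ⊕ Fin 5, (starRingEnd ℂ) (w p) * F (bsPt L z₁ z₂ p) := by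
  unfold chargeOf
  simp_rw [map_sum, Finset.sum_mul]
  rw [Finset.sum_comm]
  refine Finset.sum_congr rfl fun p _ => ?_
  simp_rw [apply_ite (starRingEnd ℂ), map_zero, ite_mul, zero_mul]
  rw [Finset.sum_ite_eq]
  simp

/-- pairing a lattice function with a charge carried by the ten points. [folklore] -/
theorem sum_mul_chargeOf (z₁ z₂ : Tor L) (w : Fin 5 ⊕ Fin 5 → ℂ) (F : Tor L → ℂ) :
    ∑ y : Tor L, F y * chargeOf L z₁ z₂ w y
      = ∑ q : Fin 5 ⊕ Fin 5, F (bsPt L z₁ z₂ q) * w q := by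
  unfold chargeOf
  simp_rw [Finset.mul_sum]
  rw [Finset.sum_comm]
  refine Finset.sum_congr rfl fun q _ => ?_
  simp_rw [mul_ite, mul_zero]
  rw [Finset.sum_ite_eq]
  simp

/-- the Green quadratic form of a carried charge is the `10 × 10` Green-matrix form. [folklore] -/
theorem greenQF_chargeOf (g : ℝ) (z₁ z₂ : Tor L) (w : Fin 5 ⊕ Fin 5 → ℂ) :
    greenQF L g (chargeOf L z₁ z₂ w)
      = ∑ p : Fin 5 ⊕ Fin 5, ∑ q : Fin 5 ⊕ Fin 5,
          (starRingEnd ℂ) (w p) * greenMat L g z₁ z₂ p q * w q := by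
  unfold greenQF
  have h1 : ∀ x : Tor L, ∑ y : Tor L, (starRingEnd ℂ) (chargeOf L z₁ z₂ w x) * greenW L g (x - y) * chargeOf L z₁ z₂ w y
      = (starRingEnd ℂ) (chargeOf L z₁ z₂ w x)
          * ∑ q : Fin 5 ⊕ Fin 5, greenW L g (x - bsPt L z₁ z₂ q) * w q := by
    intro x
    rw [← sum_mul_chargeOf L z₁ z₂ w (fun y => greenW L g (x - y)), Finset.mul_sum]
    exact Finset.sum_congr rfl fun y _ => by rw [mul_assoc]
  rw [Finset.sum_congr rfl fun x _ => h1 x,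
    sum_conj_chargeOf_mul L z₁ z₂ w (fun x => ∑ q : Fin 5 ⊕ Fin 5, greenW L g (x - bsPt L z₁ z₂ q) * w q)]
  refine Finset.sum_congr rfl fun p _ => ?_
  rw [Finset.mul_sum]
  refine Finset.sum_congr rfl fun q _ => ?_
  rw [greenMat, Matrix.of_apply, mul_assoc]

/-- **a matrix certificate is a dual certificate** (charge `c = ` the lattice charge of `E·(φ|_D)`). [folklore] -/
theorem dualCert_of_matrixCert {g : ℝ} {z₁ z₂ : Tor L} {E : Matrix (Fin 5 ⊕ Fin 5) (Fin 5 ⊕ Fin 5) ℂ}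
    (hE : MatrixCert L g z₁ z₂ E) : DualCert L g z₁ z₂ := by
  intro φ h1 h2 _hsum
  refine ⟨chargeOf L z₁ z₂ (E.mulVec (restr L z₁ z₂ φ)), ?_⟩
  rw [nbr_add_nbr L h1 h2, sum_conj_chargeOf_mul, greenQF_chargeOf]
  exact hE φ h1 h2

/-- **PROP BS (sufficiency, matrix form):** for `L ≥ 2` and `g < ε₁`, a `10 × 10` matrix certificate for every pair gives
`TwoHoleGap L g` — the finite Birman–Schwinger reduction of HOLE₂ (memo 19 §253, memo 21 §314(a)). [folklore] -/
theorem twoHoleGap_of_matrixCert (hL : 2 ≤ L) {g : ℝ} (hg : g < eps1 L)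
    (h : ∀ z₁ z₂ : Tor L, z₁ ≠ z₂ → ∃ E : Matrix (Fin 5 ⊕ Fin 5) (Fin 5 ⊕ Fin 5) ℂ, MatrixCert L g z₁ z₂ E) :
    TwoHoleGap L g :=
  twoHoleGap_of_dualCert L hL hg fun z₁ z₂ hne => by
    obtain ⟨E, hE⟩ := h z₁ z₂ hne
    exact dualCert_of_matrixCert L hE

/-- **exact-inverse form (`P̃ ⪰ 0`):** if `G̃_DD · E = 1` then the certificate inequality is `½‖ψ‖² ≤ Re ψᴴ E ψ` on boundary
data vanishing at the pair, i.e. `[(G̃_DD)⁻¹]_{BB} − ½N ⪰ 0`. [folklore] -/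
theorem matrixCert_of_inverse {g : ℝ} {z₁ z₂ : Tor L} (E : Matrix (Fin 5 ⊕ Fin 5) (Fin 5 ⊕ Fin 5) ℂ)
    (hGE : greenMat L g z₁ z₂ * E = 1)
    (hpos : ∀ φ : Tor L → ℂ, φ z₁ = 0 → φ z₂ = 0 →
      (1 / 2 : ℝ) * ∑ p : Fin 5 ⊕ Fin 5, ‖restr L z₁ z₂ φ p‖ ^ 2
        ≤ (∑ p : Fin 5 ⊕ Fin 5, (starRingEnd ℂ) (restr L z₁ z₂ φ p) * E.mulVec (restr L z₁ z₂ φ) p).re) :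
    MatrixCert L g z₁ z₂ E := by
  intro φ h1 h2
  set ψ := restr L z₁ z₂ φ with hψ
  have hGψ : (greenMat L g z₁ z₂).mulVec (E.mulVec ψ) = ψ := by
    rw [Matrix.mulVec_mulVec, hGE, Matrix.one_mulVec]
  have hG : ∀ p : Fin 5 ⊕ Fin 5, ∑ q : Fin 5 ⊕ Fin 5, greenMat L g z₁ z₂ p q * E.mulVec ψ q = ψ p :=
    fun p => congrFun hGψ p
  have h3 : ∑ p : Fin 5 ⊕ Fin 5, ∑ q : Fin 5 ⊕ Fin 5,
      (starRingEnd ℂ) (E.mulVec ψ p) * greenMat L g z₁ z₂ p q * E.mulVec ψ q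
      = ∑ p : Fin 5 ⊕ Fin 5, (starRingEnd ℂ) (E.mulVec ψ p) * ψ p := by
    refine Finset.sum_congr rfl fun p _ => ?_
    simp_rw [mul_assoc, ← Finset.mul_sum, hG]
  have h4 : (∑ p : Fin 5 ⊕ Fin 5, (starRingEnd ℂ) (ψ p) * E.mulVec ψ p).re
      = (∑ p : Fin 5 ⊕ Fin 5, (starRingEnd ℂ) (E.mulVec ψ p) * ψ p).re := by
    rw [← Complex.conj_re, map_sum]
    congr 1
    refine Finset.sum_congr rfl fun p _ => ?_
    rw [map_mul, Complex.conj_conj, mul_comm]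
  rw [h3]
  have := hpos φ h1 h2
  rw [h4] at this
  linarith

end TwoHoleBS

end Summit.HubbardSuperconductivity.HubbardSuperconductivity.Theorems.AnisotropyChord.Transfer.Fibre3

end
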